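import Literature.AlgebraicGeometry.Resolution.WeightedCentreTheoremFPrime
import Literature.AlgebraicGeometry.Resolution.WeightedCentreBottomKill
import Literature.AlgebraicGeometry.Resolution.WeightedCentreZKernel
import HarnessLib

/-!
# Weighted centres — THEOREM A⁺, endgame: a graded `k[T]`-substitution fixing `g` cannot move a (P)-pinned bottom slot

Instrument for engine 1's `W(f)` TOY MODEL (cell `pub-rosobs`, LF-MODEL-eng1-g45 §6.2 THEOREM A⁺: "… L7 at `Y := L₁` with `T := τ` ⇒ (P) fails at `L₁` ✗"), NOT a
resolution theorem and NOT about the invariant of [AbramovichTemkinWlodarczyk2024].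

`false_of_slotPinned_bottom`: let `ψ : k[ε] → k[ε][T]` be a `k`-algebra substitution with `ψ(ε_i) ≡ ε_i (mod T)` whose `T^n`-coefficients weigh `w i − n·w z` (`T` of weight
`w z > 0`, weights `≥ 0`), let `z` be a slot of MINIMAL weight with `ψ(ε_z) = ε_z + cT`, `c ≠ 0`, and let `ψ(g) = g`.  Then `g` is NOT (P)-pinned at `z`
(`Truncation.SlotPinned`): the kill coordinates `(Λ⁻¹, Λ)` (`WeightedCentreBottomKill.bottomKill`) are a graded automorphism pair (`KillCoordinates.isWeightedHomogeneous_killEquiv`),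
so (P) transports to `ClassPinned (class z) (Λ⁻¹ g) z` (`Truncation.SlotPinned.classPinned_apply`), contradicting L7 (`not_classPinned_bottomKill`).  This is the common last
paragraph of both cases of THEOREM A⁺; the substitution `ψ` is supplied by `WeightedCentreBottomExpand` / `WeightedCentreBottomData` / `WeightedCentreBottomDatum`.

References: [Lang2002, Ch. IV §1, Ch. XIII §4]; [Matsumura1987, §27]; [AbramovichTemkinWlodarczyk2024, §5.1 (p. 1575), Lemma 5.2.10 (p. 1577), Thm. 5.3.1 (2)–(3) (p. 1578)].
-/

namespace Literature.AlgebraicGeometry.Resolution.WeightedBlowup.BottomClimb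

open Polynomial Truncation InvariantDirection

section Endgame

variable {k : Type*} [Field k] {ι : Type*} [Fintype ι] [DecidableEq ι] {w : ι → ℚ}

omit [Fintype ι] [DecidableEq ι] in
/-- **`T^n`-coefficients of weight `w i − n·w z` (`w z > 0`, weights `≥ 0`) involve only variables lighter than `ε_i` for `n ≥ 1`** (the hypothesis `htri` of
`killRank_lt_of_bottom` from gradedness; bookkeeping on `ZKernel.le_of_mem_vars`). [cite: AbramovichTemkinWlodarczyk2024, Lemma 5.2.10 (p. 1577)] -/
theorem lt_of_mem_vars_coeff_of_graded (hw : ∀ i, 0 ≤ w i) (ψ : MvPolynomial ι k →ₐ[k] (MvPolynomial ι k)[X]) {z : ι} (hwz : 0 < w z)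
    (hψw : ∀ i n, MvPolynomial.IsWeightedHomogeneous w ((ψ (MvPolynomial.X i)).coeff n) (w i - n • w z)) :
    ∀ i, ∀ n, 1 ≤ n → ∀ j ∈ ((ψ (MvPolynomial.X i)).coeff n).vars, w j < w i := fun i n hn j hj => by
  have hle := ZKernel.le_of_mem_vars hw (hψw i n) hj
  rw [nsmul_eq_mul] at hle
  have h1 : (1 : ℚ) ≤ n := by exact_mod_cast hn
  nlinarith

/-- **The kill coordinates `(Λ⁻¹, Λ)` of THEOREM A⁺ are a graded automorphism pair** when `ψ` is graded with `wt T = w z` (bookkeeping over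
`KillCoordinates.isWeightedHomogeneous_killEquiv`, as `TailedLightFlow.IsTailedLightFlow.isGradedAutPair_kill_symm`). [cite: AbramovichTemkinWlodarczyk2024, Lemma 5.2.10 (p. 1577)] -/
theorem isGradedAutPair_bottomKill_symm (ψ : MvPolynomial ι k →ₐ[k] (MvPolynomial ι k)[X]) (z : ι) (c : k) (hmin : ∀ j, w z ≤ w j)
    (h0 : ∀ i, (ψ (MvPolynomial.X i)).coeff 0 = MvPolynomial.X i)
    (htri : ∀ i, ∀ n, 1 ≤ n → ∀ j ∈ ((ψ (MvPolynomial.X i)).coeff n).vars, w j < w i)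
    (hψw : ∀ i n, MvPolynomial.IsWeightedHomogeneous w ((ψ (MvPolynomial.X i)).coeff n) (w i - n • w z)) :
    IsGradedAutPair w ((bottomKill ψ z c hmin h0 htri).symm : MvPolynomial ι k →ₐ[k] MvPolynomial ι k)
      (bottomKill ψ z c hmin h0 htri : MvPolynomial ι k →ₐ[k] MvPolynomial ι k) := by
  refine ⟨fun i => ?_, fun i => ?_, fun g => by simp, fun g => by simp⟩
  · simpa [bottomKill] using (KillCoordinates.isWeightedHomogeneous_killEquiv ψ z c _ (killRank_lt_of_bottom ψ z c hmin h0 htri) w hψw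
      (MvPolynomial.isWeightedHomogeneous_X k w i)).2
  · simpa [bottomKill] using (KillCoordinates.isWeightedHomogeneous_killEquiv ψ z c _ (killRank_lt_of_bottom ψ z c hmin h0 htri) w hψw
      (MvPolynomial.isWeightedHomogeneous_X k w i)).1

/-- **THEOREM A⁺, ENDGAME: a graded `k[T]`-substitution fixing `g` cannot move a (P)-pinned slot of minimal weight.**  `ψ(ε_i) ≡ ε_i (mod T)`, `[T^n]ψ(ε_i)` of weight
`w i − n·w z` (`0 < w z ≤ w j` for all `j`, weights `≥ 0`), `ψ(ε_z) = ε_z + cT` with `c ≠ 0`, `ψ(g) = g`, and `g` (P)-pinned at `z` ⇒ `False` (kill coordinates are a graded pair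
⇒ (P) transports to `ClassPinned`; L7 says it fails).  Instrument for engine 1's `W(f)` toy model, NOT a resolution theorem.
[cite: AbramovichTemkinWlodarczyk2024, §5.1 (p. 1575), Thm. 5.3.1 (2)–(3) (p. 1578); Lang2002, Ch. IV §1, Ch. XIII §4; Matsumura1987, §27 (p. 207)] -/
theorem false_of_slotPinned_bottom (hw : ∀ i, 0 ≤ w i) (ψ : MvPolynomial ι k →ₐ[k] (MvPolynomial ι k)[X]) {z : ι} {c : k}
    (hmin : ∀ j, w z ≤ w j) (hwz : 0 < w z) (h0 : ∀ i, (ψ (MvPolynomial.X i)).coeff 0 = MvPolynomial.X i)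
    (hψw : ∀ i n, MvPolynomial.IsWeightedHomogeneous w ((ψ (MvPolynomial.X i)).coeff n) (w i - n • w z)) (hc : c ≠ 0)
    (hz : ψ (MvPolynomial.X z) = C (MvPolynomial.X z) + C (MvPolynomial.C c) * X) {g : MvPolynomial ι k} (hg : ψ g = C g)
    (hP : SlotPinned w z g) : False := by
  have htri := lt_of_mem_vars_coeff_of_graded hw ψ hwz hψw
  have h2 := hP.classPinned_apply w (isGradedAutPair_bottomKill_symm ψ z c hmin h0 htri hψw)
  have hzS : z ∈ Finset.univ.filter (fun j => w j = w z) := Finset.mem_filter.mpr ⟨Finset.mem_univ z, rfl⟩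
  exact not_classPinned_bottomKill ψ z hmin h0 htri hc hz hg hzS (by simpa using h2)

end Endgame

end Literature.AlgebraicGeometry.Resolution.WeightedBlowup.BottomClimb
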